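import Summits.CriticalPhenomena.PercolationContinuityZ3.Theorems.PercNearOneGluingNoHeavyLowerTailSahiParamLayer

/-!
# `NoHeavyLowerTail` (crux stmt-CriticalPhenomena-4575), Sahi programme P1: the TWO-LAYER class — where the smallest open
# lattices of Sahi's conjecture actually live

Support file (Sahi cell, seat `prim-sahi-p1`, generation 5; `--supports stmt-CriticalPhenomena-4575`).  Pure proofs, no
definitions, standard axioms.  Specialisation `T = Fin 2`, `d = 2` of the parametrised layers of `…SahiParamLayer` (every
probability weight on the two-point chain is FKG):

* `twoLayer_iff_fkg n` / `twoLayer_iff_uniform n`: Sahi's `E_n ≥ 0` for every FKG probability weight on every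
  `[2] × [b+1]²` ⟺ for every product weight `ν ⊗ g ⊗ g'` on `[2] × [K+1]²` ⟺ for every `ν ⊗ uniform([M]²)` — TWO COUPLED
  COPIES of Lieb–Sahi's discrete square: monotone families on `{0,1} × [M]²` under the weight `ν(t)/M²`.  At `n = 3` and
  indicator functions (`twoLayer_three_iff_upSets`, layer cake) this is the "two-row Lieb–Sahi inequality": for three
  pairs of staircases `a ≥ a'`, `b ≥ b'`, `c ≥ c'` in `𝒜(M)` and `λ ∈ [0,1]`, `E_3 ≥ 0` for the moments
  `E(a,a') = ((1−λ)S(a) + λS(a'))/M²`, `E(ab) = ((1−λ)S(a∧b) + λS(a'∧b'))/M²`, … .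
* `twoLayer_of_fkg_grid_three` / `twoLayer_of_uniformGrid_three`: layer three (`W(3,n)`, equivalently `U(3,n)`) implies
  the two-layer statement (zero extension along the sublattice `[2]×[b+1]² ↪ [b+2]³`, `twoLayer_embedding`).
* What two layers settle, at the same order `n`: every FKG weight on every `[2]×[a+1]×[c+1]`
  (`sahiPositive_twoChainProd_of_twoLayer`), on `V+pt = 2 × WithBot(2²)` (`sahiPositive_withBotSqTwo_of_twoLayer`), on
  `Λ+pt = 2 × WithTop(2²)` (`sahiPositive_withTopSqTwo_of_twoLayer`), on `[2]×[2]×[3]` (`sahiPositive_prod223_of_twoLayer`)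
  — ALL the smallest lattices on which Sahi's conjecture is not a tree theorem, except `2⁴` (width 4).  So the first open
  problem of this programme is not "the cube `[M]³`" but the thinner two-layer statement; orders `n ≤ 2` are theorems
  (`twoLayer_of_order_le_two`).

Census (this seat, code `prim-sahi-p1/code/gen5/tworow.c`): the two-row Lieb–Sahi inequality holds for `M ≤ 4` and EVERY
`λ ∈ [0,1]` (all 916 395 060 sorted triples of staircase pairs at `M = 4`; the cubic in `λ` minimised exactly on `[0,1]`;
0 negative).  Nothing open is asserted: the two-layer statement appears only as a hypothesis or as one side of an
equivalence.  New mathematics (the organisation), standard ingredients.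
-/

namespace Summit.CriticalPhenomena.PercolationContinuityZ3.Theorems.SahiLayer

open Finset Function Filter Topology Literature.Combinatorics.Sahi2008 ProductChains SahiWidth SahiTwoDim SahiThreeDim
open scoped BigOperators

noncomputable section

/-! ## The two-layer class: `T = Fin 2`, `d = 2` -/

section TwoLayer

variable {n : ℕ}

/-- **THE TWO-LAYER CLASS, product ⟺ FKG**: Sahi's `E_n ≥ 0` for every product weight `ν ⊗ g ⊗ g'` on `[2] × [K+1]²`
(`ν` any probability weight on the two-point chain) ⟺ for every FKG probability weight on every `[2] × [b+1]²`. [this work] -/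
theorem twoLayer_iff_fkg (n : ℕ) :
    (∀ (K : ℕ) (ν : Fin 2 → ℝ), (∀ t, 0 ≤ ν t) → ∑ t, ν t = 1 → ∀ (g : Fin 2 → Fin (K + 1) → ℝ), (∀ i u, 0 ≤ g i u) →
      (∀ i, ∑ u, g i u = 1) → SahiPositive (fun x : Fin 2 × (Fin 2 → Fin (K + 1)) => ν x.1 * ∏ i, g i (x.2 i)) n) ↔
    ∀ (b : ℕ) (μ : Fin 2 × (Fin 2 → Fin (b + 1)) → ℝ), IsFKGMeasure μ → SahiPositive μ n := by
  rw [← param_grid_iff_fkg (Fin 2) 2 n]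
  exact ⟨fun H K ν hν g hg0 hg1 => H K ν hν.nonneg hν.sum_eq_one g hg0 hg1,
    fun H K ν h0 h1 g hg0 hg1 => H K ν (isFKGMeasure_of_linearOrder h0 h1) g hg0 hg1⟩

/-- **THE TWO-LAYER CLASS, FKG ⟺ uniform**: … ⟺ Sahi's `E_n ≥ 0` for every weight `ν(t)/M²` on `[2] × [M]²` — two coupled
copies of Lieb–Sahi's discrete square (`ν` a probability weight on `{0,1}`, `M ≥ 1`). [this work] -/
theorem twoLayer_iff_uniform (n : ℕ) :
    (∀ (b : ℕ) (μ : Fin 2 × (Fin 2 → Fin (b + 1)) → ℝ), IsFKGMeasure μ → SahiPositive μ n) ↔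
    ∀ (ν : Fin 2 → ℝ), (∀ t, 0 ≤ ν t) → ∑ t, ν t = 1 → ∀ M, 0 < M →
      SahiPositive (fun x : Fin 2 × (Fin 2 → Fin M) => ν x.1 * ((1 : ℝ) / (M : ℝ) ^ 2)) n := by
  rw [param_fkg_iff_uniform (Fin 2) 2 n]
  exact ⟨fun H ν h0 h1 M hM => H ν (isFKGMeasure_of_linearOrder h0 h1) M hM,
    fun H ν hν M hM => H ν hν.nonneg hν.sum_eq_one M hM⟩

/-- **Order three, indicator form (the two-row Lieb–Sahi inequality)**: the two-layer statement at `n = 3` is equivalent to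
`E_3(1_A, 1_B, 1_C) ≥ 0` for all up-sets `A, B, C` of `[2] × [M]²` under the weights `ν(t)/M²` (layer cake,
`sahiPositive_iff_indicators`). [this work] -/
theorem twoLayer_three_iff_upSets :
    (∀ (ν : Fin 2 → ℝ), (∀ t, 0 ≤ ν t) → ∑ t, ν t = 1 → ∀ M, 0 < M →
      SahiPositive (fun x : Fin 2 × (Fin 2 → Fin M) => ν x.1 * ((1 : ℝ) / (M : ℝ) ^ 2)) 3) ↔
    ∀ (ν : Fin 2 → ℝ), (∀ t, 0 ≤ ν t) → ∑ t, ν t = 1 → ∀ M, 0 < M →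
      ∀ U : Fin 3 → Finset (Fin 2 × (Fin 2 → Fin M)), (∀ i, IsUpperSet ((U i : Finset _) : Set (Fin 2 × (Fin 2 → Fin M)))) →
        0 ≤ sahiE (fun x : Fin 2 × (Fin 2 → Fin M) => ν x.1 * ((1 : ℝ) / (M : ℝ) ^ 2)) 3 (fun i => setInd (U i)) := by
  classical
  constructor
  · intro H ν h0 h1 M hM U hU
    exact (sahiPositive_iff_indicators _ 3).1 (H ν h0 h1 M hM) U hU
  · intro H ν h0 h1 M hM
    exact (sahiPositive_iff_indicators _ 3).2 (H ν h0 h1 M hM)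

/-! ### Layer three implies the two-layer statement -/

/-- The sublattice `[2] × [b+1]² ↪ [b+2]³`, `(t, ω) ↦ (t, ω_0, ω_1)`. [folklore] -/
theorem twoLayer_embedding (b : ℕ) :
    ∃ e : Fin 2 × (Fin 2 → Fin (b + 1)) → (Fin 3 → Fin (b + 1 + 1)), Function.Injective e ∧
      (∀ x y, e (x ⊓ y) = e x ⊓ e y) ∧ (∀ x y, e (x ⊔ y) = e x ⊔ e y) := by
  have h2 : 2 ≤ b + 1 + 1 := by omega
  refine ⟨fun x => Fin.cons (Fin.castLE h2 x.1) (fun i => Fin.castSucc (x.2 i)), ?_, ?_, ?_⟩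
  · intro x y hxy
    have h0 := congrFun hxy 0
    simp only [Fin.cons_zero] at h0
    refine Prod.ext (Fin.castLE_injective h2 h0) (funext fun i => ?_)
    have hi := congrFun hxy i.succ
    simp only [Fin.cons_succ] at hi
    exact Fin.castSucc_injective _ hi
  · intro x y
    funext j
    refine Fin.cases ?_ (fun i => ?_) j
    · simp only [Pi.inf_apply, Fin.cons_zero, Prod.fst_inf]
      exact (Fin.strictMono_castLE h2).monotone.map_inf _ _
    · simp only [Pi.inf_apply, Fin.cons_succ, Prod.snd_inf]
      exact Fin.strictMono_castSucc.monotone.map_inf _ _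
  · intro x y
    funext j
    refine Fin.cases ?_ (fun i => ?_) j
    · simp only [Pi.sup_apply, Fin.cons_zero, Prod.fst_sup]
      exact (Fin.strictMono_castLE h2).monotone.map_sup _ _
    · simp only [Pi.sup_apply, Fin.cons_succ, Prod.snd_sup]
      exact Fin.strictMono_castSucc.monotone.map_sup _ _

/-- **Layer three ⟹ two layers**: if every FKG probability weight on every grid `[b+1]³` is Sahi-positive at order `n`
(`W(3,n)`), then so is every FKG probability weight on every `[2] × [b+1]²`. [this work] -/
theorem twoLayer_of_fkg_grid_three
    (W3 : ∀ (b : ℕ) (μ : (Fin 3 → Fin (b + 1)) → ℝ), IsFKGMeasure μ → SahiPositive μ n)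
    {b : ℕ} {μ : Fin 2 × (Fin 2 → Fin (b + 1)) → ℝ} (hμ : IsFKGMeasure μ) : SahiPositive μ n := by
  classical
  obtain ⟨e, he, hinf, hsup⟩ := twoLayer_embedding b
  exact sahiPositive_of_latticeEmbedding_order e he hinf hsup (W3 (b + 1)) hμ

/-- **Layer three in uniform form ⟹ two layers**: under `U(3,n)` (the uniform weight on every box `[M]³` is Sahi-positive at
order `n`), every FKG probability weight on every `[2] × [b+1]²` is Sahi-positive at order `n`. [this work] -/
theorem twoLayer_of_uniformGrid_three
    (hU : ∀ M, 0 < M → SahiPositive (fun _ : Fin 3 → Fin M => (1 : ℝ) / (M : ℝ) ^ 3) n)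
    {b : ℕ} {μ : Fin 2 × (Fin 2 → Fin (b + 1)) → ℝ} (hμ : IsFKGMeasure μ) : SahiPositive μ n :=
  twoLayer_of_fkg_grid_three ((fkg_grid_iff_uniform 3 n).1 hU) hμ

/-! ### What the two-layer statement settles -/

/-- **`[2]×[a+1]×[c+1]` is two-layer**: under the two-layer statement at order `n`, every FKG probability weight on
`Fin 2 × Fin (a+1) × Fin (c+1)` is Sahi-positive at order `n` (sublattice of `[2]×[b+1]²`, `b = max a c`). [this work] -/
theorem sahiPositive_twoChainProd_of_twoLayer
    (TL : ∀ (b : ℕ) (μ : Fin 2 × (Fin 2 → Fin (b + 1)) → ℝ), IsFKGMeasure μ → SahiPositive μ n)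
    {a c : ℕ} {μ : Fin 2 × (Fin (a + 1) × Fin (c + 1)) → ℝ} (hμ : IsFKGMeasure μ) : SahiPositive μ n := by
  classical
  have ha : a + 1 ≤ max a c + 1 := by omega
  have hc : c + 1 ≤ max a c + 1 := by omega
  refine sahiPositive_of_latticeEmbedding_order
    (fun x : Fin 2 × (Fin (a + 1) × Fin (c + 1)) => (x.1, ![Fin.castLE ha x.2.1, Fin.castLE hc x.2.2]))
    ?_ ?_ ?_ (TL (max a c)) hμ
  · intro x y hxy
    obtain ⟨h1, h2⟩ := Prod.mk.inj hxy
    have h20 := congrFun h2 0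
    have h21 := congrFun h2 1
    simp only [Matrix.cons_val_zero, Matrix.cons_val_one] at h20 h21
    exact Prod.ext h1 (Prod.ext (Fin.castLE_injective ha h20) (Fin.castLE_injective hc h21))
  · intro x y
    refine Prod.ext rfl (funext fun i => ?_)
    fin_cases i
    · simp only [Prod.snd_inf, Pi.inf_apply, Fin.zero_eta, Matrix.cons_val_zero, Prod.fst_inf]
      exact (Fin.strictMono_castLE ha).monotone.map_inf _ _
    · simp only [Prod.snd_inf, Pi.inf_apply, Fin.mk_one, Matrix.cons_val_one, Prod.snd_inf]
      exact (Fin.strictMono_castLE hc).monotone.map_inf _ _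
  · intro x y
    refine Prod.ext rfl (funext fun i => ?_)
    fin_cases i
    · simp only [Prod.snd_sup, Pi.sup_apply, Fin.zero_eta, Matrix.cons_val_zero, Prod.fst_sup]
      exact (Fin.strictMono_castLE ha).monotone.map_sup _ _
    · simp only [Prod.snd_sup, Pi.sup_apply, Fin.mk_one, Matrix.cons_val_one, Prod.snd_sup]
      exact (Fin.strictMono_castLE hc).monotone.map_sup _ _

/-- **The two-layer class in product-of-chains form**: the two-layer statement at order `n` is equivalent to order-`n` Sahi
positivity of every FKG probability weight on every product `[2]×[a+1]×[c+1]` of the two-point chain with two finite chains.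
[this work] -/
theorem twoLayer_iff_twoChainProd (n : ℕ) :
    (∀ (b : ℕ) (μ : Fin 2 × (Fin 2 → Fin (b + 1)) → ℝ), IsFKGMeasure μ → SahiPositive μ n) ↔
    ∀ (a c : ℕ) (μ : Fin 2 × (Fin (a + 1) × Fin (c + 1)) → ℝ), IsFKGMeasure μ → SahiPositive μ n := by
  classical
  refine ⟨fun TL a c μ hμ => sahiPositive_twoChainProd_of_twoLayer TL hμ, fun H b μ hμ => ?_⟩
  refine sahiPositive_of_latticeEmbedding_order
    (fun x : Fin 2 × (Fin 2 → Fin (b + 1)) => (x.1, (x.2 0, x.2 1))) ?_ ?_ ?_ (H b b) hμ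
  · intro x y hxy
    obtain ⟨h1, h2⟩ := Prod.mk.inj hxy
    obtain ⟨h20, h21⟩ := Prod.mk.inj h2
    refine Prod.ext h1 (funext fun i => ?_)
    fin_cases i
    · exact h20
    · exact h21
  · intro x y; rfl
  · intro x y; rfl

/-- **`[2]×[2]×[3]` (12 elements, the smallest lattice on which Sahi's conjecture is not a tree theorem) is two-layer.**
[this work] -/
theorem sahiPositive_prod223_of_twoLayer
    (TL : ∀ (b : ℕ) (μ : Fin 2 × (Fin 2 → Fin (b + 1)) → ℝ), IsFKGMeasure μ → SahiPositive μ n)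
    {μ : Fin 2 × (Fin 2 × Fin 3) → ℝ} (hμ : IsFKGMeasure μ) : SahiPositive μ n :=
  sahiPositive_twoChainProd_of_twoLayer (a := 1) (c := 2) TL hμ

/-- **`V+pt = WithBot(2²)×2` is two-layer**: under the two-layer statement at order `n`, every FKG probability weight on
`Fin 2 × WithBot (Fin 2 × Fin 2)` is Sahi-positive at order `n` (embedding `⊥ ↦ (0,0)`, `(u,v) ↦ (u+1,v+1)` of `WithBot(2²)`
into `[3]²`, checked by `decide`). [this work] -/
theorem sahiPositive_withBotSqTwo_of_twoLayer
    (TL : ∀ (b : ℕ) (μ : Fin 2 × (Fin 2 → Fin (b + 1)) → ℝ), IsFKGMeasure μ → SahiPositive μ n)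
    {μ : Fin 2 × WithBot (Fin 2 × Fin 2) → ℝ} (hμ : IsFKGMeasure μ) : SahiPositive μ n :=
  sahiPositive_of_latticeEmbedding_order
    (fun x : Fin 2 × WithBot (Fin 2 × Fin 2) =>
      (x.1, WithBot.recBotCoe (![0, 0] : Fin 2 → Fin 3) (fun p => ![Fin.succ p.1, Fin.succ p.2]) x.2))
    (by decide) (by decide) (by decide) (TL 2) hμ

/-- **`Λ+pt = WithTop(2²)×2` is two-layer** (embedding `(u,v) ↦ (u,v)`, `⊤ ↦ (2,2)` of `WithTop(2²)` into `[3]²`).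
[this work] -/
theorem sahiPositive_withTopSqTwo_of_twoLayer
    (TL : ∀ (b : ℕ) (μ : Fin 2 × (Fin 2 → Fin (b + 1)) → ℝ), IsFKGMeasure μ → SahiPositive μ n)
    {μ : Fin 2 × WithTop (Fin 2 × Fin 2) → ℝ} (hμ : IsFKGMeasure μ) : SahiPositive μ n :=
  sahiPositive_of_latticeEmbedding_order
    (fun x : Fin 2 × WithTop (Fin 2 × Fin 2) =>
      (x.1, WithTop.recTopCoe (![2, 2] : Fin 2 → Fin 3) (fun p => ![Fin.castSucc p.1, Fin.castSucc p.2]) x.2))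
    (by decide) (by decide) (by decide) (TL 2) hμ

/-- **The two-layer statement holds at orders `n ≤ 2`** (every FKG weight is Sahi-positive at orders `≤ 2`: `E_1 = E ≥ 0`,
`E_2` = FKG). [folklore] -/
theorem twoLayer_of_order_le_two (hn : n ≤ 2) (b : ℕ) (μ : Fin 2 × (Fin 2 → Fin (b + 1)) → ℝ)
    (hμ : IsFKGMeasure μ) : SahiPositive μ n :=
  twoLayer_of_uniformGrid_three (uniformGrid_of_order_le_two hn) hμ

end TwoLayer

end

end Summit.CriticalPhenomena.PercolationContinuityZ3.Theorems.SahiLayer
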